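import Summits.ResolutionOfSingularities.ResolutionOfSingularities.Theorems.EquisingularLiftEquisingularLiftNatSubmaxLinChartsN
import HarnessLib

/-!
# [OURS · EL♮] HYPERSURFACES IN `ℙ^{r+2}` WITH `V(x_{r+1}, x_{r+2})` OF SUBMAXIMAL MULTIPLICITY — THE STRICT TRANSFORMS ARE REGULAR AND NOT
# DIVISIBLE BY THE EXCEPTIONAL VARIABLE (crux `Theses.EquisingularLift.EquisingularLiftNat`, stmt-ResolutionOfSingularities-20038)

[OURS · leafhand-res-equisingularlift-7 g0, 2026-08-31; cell `pub/decomp-res`] AI-produced, weaker than expert review; NOT a statement of any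
manuscript; nothing here proves resolution of singularities in positive characteristic.  DEF-FREE helper; no `sorry`; standard axioms; ZERO named
hypotheses.  Continues `…NatSubmaxLinChartsN` (`F = Σ_{j ≤ r} x_j·A_j(x_{r+1},x_{r+2}) + C(x_{r+1},x_{r+2})`): on the centre chart `c = x_i` with
exceptional variable `y_{r+a}` the strict transform is `f′ = Σ_j u_j·A_j(g′) + y_{r+a}·C(g′)` (`u_i = 1`, `u_j = y_{l_j}` otherwise).

* `eq_zero_of_aeval_eq_zeroN` — dehomogenisation is injective on binary forms (general chart variables);
* ★ `not_X_dvd_strict` — `y_{r+a} ∤ f′` as soon as some `A_j ≠ 0` (kill `y_{r+a}`, differentiate in the `y_{l_j}`);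
* ★ `isRegularRing_quotient_strict` — `K[y]/(f′)` is regular as soon as `(A_j)_j, C` have no common zero on `ℙ¹` (engine `isRegularRing_quotient_linN`).
-/

set_option linter.dupNamespace false -- mandated namespace `Summit.<Summit>.<Problem>` of this single-conjunct summit

noncomputable section

open MvPolynomial
open Literature.AlgebraicGeometry.Resolution
open Literature.AlgebraicGeometry.Motives

namespace Summit.ResolutionOfSingularities.ResolutionOfSingularities.Cruxes.EquisingularLiftNat.Sections

namespace SubmaxLinN

variable (K : Type) [Field K] {r : ℕ}

/-- **Dehomogenisation is injective on binary forms** (general form): if `g_a = 1` and `g_{a'} = y_k` (`a ≠ a'`), then `G(g) = 0 ⟹ G = 0`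
(`K` infinite). [folklore] -/
theorem eq_zero_of_aeval_eq_zeroN [Infinite K] {N : ℕ} (G : MvPolynomial (Fin 2) K) {m : ℕ} (hG : G.IsHomogeneous m)
    (a a' : Fin 2) (haa' : a ≠ a') (k : Fin N) (g : Fin 2 → MvPolynomial (Fin N) K) (hga : g a = 1) (hga' : g a' = X k)
    (h : aeval g G = 0) : G = 0 := by
  have hb : ∀ b : Fin 2, b = a ∨ b = a' := by
    intro b
    fin_cases a <;> fin_cases a' <;> fin_cases b <;> simp_all
  have hGX : (G * X a).IsHomogeneous (m + 1) := hG.mul (isHomogeneous_X K a)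
  have hzero : G * X a = 0 := by
    refine hGX.eq_zero_of_forall_eval_eq_zero fun v => ?_
    rw [map_mul, eval_X]
    by_cases hv : v a = 0
    · rw [hv, mul_zero]
    · let x : Fin N → K := fun _ => v a' / v a
      have hw : v = v a • (fun b => aeval x (g b)) := by
        funext b
        rcases hb b with rfl | rfl
        · simp [hga]
        · simp only [hga', Pi.smul_apply, smul_eq_mul, aeval_X, x]
          rw [mul_div_cancel₀ _ hv]
      have h1 : MvPolynomial.eval v G = v a ^ m * MvPolynomial.eval (fun b => aeval x (g b)) G := by
        conv_lhs => rw [hw]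
        exact SubmaxLine.eval_smul_of_isHomogeneous K hG (v a) _
      have h2 : MvPolynomial.eval (fun b => aeval x (g b)) G = 0 := by
        have h3 := congrArg (aeval x) h
        rw [SubmaxLine.aeval_aeval_point, map_zero] at h3
        rw [← coe_aeval_eq_eval]
        exact h3
      rw [h1, h2, mul_zero, zero_mul]
  exact (mul_eq_zero.mp hzero).resolve_right (X_ne_zero a)

section Family

variable {d : ℕ} (A : Fin (r + 1) → MvPolynomial (Fin 2) K) (C : MvPolynomial (Fin 2) K)
  (hA : ∀ j, (A j).IsHomogeneous (d + 1)) (hC : C.IsHomogeneous (d + 2)) (i : Fin (r + 1)) (a : Fin 2)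

/-- The partials in the non-centre chart coordinates kill `G(g′)`. [folklore] -/
theorem pderiv_aeval_g'_of_lt (l : Fin (r + 1 + 1)) (hl : (l : ℕ) < r) (G : MvPolynomial (Fin 2) K) :
    pderiv l (aeval (fun b : Fin 2 => if b = a then (1 : MvPolynomial (Fin (r + 1 + 1)) K) else X ⟨r + b, by omega⟩) G) = 0 := by
  refine SubmaxLine.pderiv_aeval_eq_zero K l _ (fun b => ?_) G
  by_cases hb : b = a
  · simp only [hb, if_true]
    exact (pderiv l).map_one_eq_zero
  · simp only [if_neg hb]
    exact pderiv_X_of_ne (fun h => by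
      have := congrArg Fin.val h
      simp at this
      omega)

/-- The partial in the exceptional variable `y_{r+a}` kills `G(g′)`. [folklore] -/
theorem pderiv_aeval_g'_self (G : MvPolynomial (Fin 2) K) :
    pderiv (⟨r + a, by omega⟩ : Fin (r + 1 + 1))
      (aeval (fun b : Fin 2 => if b = a then (1 : MvPolynomial (Fin (r + 1 + 1)) K) else X ⟨r + b, by omega⟩) G) = 0 := by
  refine SubmaxLine.pderiv_aeval_eq_zero K _ _ (fun b => ?_) G
  by_cases hb : b = a
  · simp only [hb, if_true]
    exact (pderiv _).map_one_eq_zero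
  · simp only [if_neg hb]
    exact pderiv_X_of_ne (fun h => by
      apply hb
      have := congrArg Fin.val h
      simp at this
      exact Fin.ext (by omega))

include hA in
/-- ★ **The strict transform is not divisible by the exceptional variable** `y_{r+a}` as soon as some `A_j ≠ 0`: killing `y_{r+a}` leaves
`Σ_j u_j·A_j(g′) = 0`; differentiating in `y_{l_j}` gives `A_j(g′) = 0` for `j ≠ i`, then `A_i(g′) = 0`; dehomogenisation is injective. [folklore] -/
theorem not_X_dvd_strict [Infinite K] (hAne : ∃ j, A j ≠ 0) :
    ¬ ((X ⟨r + a, by omega⟩ : MvPolynomial (Fin (r + 1 + 1)) K) ∣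
      (∑ j : Fin (r + 1), ProjectiveSpace.dehomogenize K (i.castSucc.castSucc : Fin (r + 1 + 1 + 1))
            (X (j.castSucc.castSucc) : MvPolynomial (Fin (r + 1 + 1 + 1)) K) *
          aeval (fun b : Fin 2 => if b = a then (1 : MvPolynomial (Fin (r + 1 + 1)) K) else X ⟨r + b, by omega⟩) (A j) +
        X ⟨r + a, by omega⟩ *
          aeval (fun b : Fin 2 => if b = a then (1 : MvPolynomial (Fin (r + 1 + 1)) K) else X ⟨r + b, by omega⟩) C)) := by
  classical
  rintro ⟨w, hw⟩
  -- notation-free abbreviations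
  set g' : Fin 2 → MvPolynomial (Fin (r + 1 + 1)) K :=
    fun b : Fin 2 => if b = a then (1 : MvPolynomial (Fin (r + 1 + 1)) K) else X ⟨r + b, by omega⟩ with hg'
  set u : Fin (r + 1) → MvPolynomial (Fin (r + 1 + 1)) K := fun j => ProjectiveSpace.dehomogenize K
    (i.castSucc.castSucc : Fin (r + 1 + 1 + 1)) (X (j.castSucc.castSucc) : MvPolynomial (Fin (r + 1 + 1 + 1)) K) with hu
  -- kill `y_{r+a}`
  let φ : MvPolynomial (Fin (r + 1 + 1)) K →ₐ[K] MvPolynomial (Fin (r + 1 + 1)) K :=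
    aeval (Function.update (X : Fin (r + 1 + 1) → MvPolynomial (Fin (r + 1 + 1)) K) ⟨r + a, by omega⟩ 0)
  have hφX : ∀ l : Fin (r + 1 + 1), l ≠ ⟨r + a, by omega⟩ → φ (X l) = X l := by
    intro l hl
    simp only [φ, aeval_X, Function.update_of_ne hl]
  have hφ0 : φ (X ⟨r + a, by omega⟩) = 0 := by simp [φ]
  have hφu : ∀ j, φ (u j) = u j := by
    intro j
    by_cases hji : j = i
    · rw [hji, hu]
      simp only
      rw [dehomogenize_surv_X_self, map_one]
    · obtain ⟨l, hl, -, hX⟩ := dehomogenize_surv_X_surv_of_ne K i j hji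
      simp only [hu]
      rw [hX]
      exact hφX l (fun h => by
        have := congrArg Fin.val h
        simp at this
        omega)
  have hφg : ∀ G : MvPolynomial (Fin 2) K, φ (aeval g' G) = aeval g' G := by
    intro G
    rw [comp_aeval_apply]
    have hfun : (fun b => φ (g' b)) = g' := by
      funext b
      by_cases hb : b = a
      · simp only [hg', hb, if_true, map_one]
      · simp only [hg', if_neg hb]
        exact hφX _ (fun h => by
          apply hb
          have := congrArg Fin.val h
          simp at this
          exact Fin.ext (by omega))
    rw [hfun]
  have h0 : ∑ j, u j * aeval g' (A j) = 0 := by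
    have h := congrArg φ hw
    rw [map_add, map_sum, map_mul, map_mul, hφ0, zero_mul, zero_mul, add_zero] at h
    rw [← h]
    exact (Finset.sum_congr rfl fun j _ => by rw [map_mul, hφu, hφg]).symm
  -- differentiate in `y_{l_j}` for `j ≠ i`
  have hne : ∀ j, j ≠ i → aeval g' (A j) = 0 := by
    intro j hji
    obtain ⟨l, hl, hsl, hX⟩ := dehomogenize_surv_X_surv_of_ne K i j hji
    have h := congrArg (pderiv l : MvPolynomial (Fin (r + 1 + 1)) K → MvPolynomial (Fin (r + 1 + 1)) K) h0
    rw [map_sum, map_zero] at h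
    rw [Finset.sum_eq_single j] at h
    · rw [Derivation.leibniz, pderiv_aeval_g'_of_lt K a l hl, smul_zero, zero_add] at h
      have huj : u j = X l := hX
      rw [huj, pderiv_X_self, smul_eq_mul, mul_one] at h
      exact h
    · intro j' _ hj'
      rw [Derivation.leibniz, pderiv_aeval_g'_of_lt K a l hl, smul_zero, zero_add]
      by_cases hj'i : j' = i
      · rw [hj'i]
        have hui : u i = 1 := dehomogenize_surv_X_self K i
        rw [hui, (pderiv l).map_one_eq_zero, smul_zero]
      · obtain ⟨l', -, hsl', hX'⟩ := dehomogenize_surv_X_surv_of_ne K i j' hj'i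
        have huj' : u j' = X l' := hX'
        rw [huj', pderiv_X_of_ne, smul_zero]
        intro hll'
        apply hj'
        rw [hll'] at hsl'
        exact Fin.castSucc_injective _ (Fin.castSucc_injective _ (hsl'.symm.trans hsl))
    · intro h
      exact absurd (Finset.mem_univ j) h
  -- then `j = i`
  have hi : aeval g' (A i) = 0 := by
    rw [Finset.sum_eq_single i] at h0
    · have hui : u i = 1 := dehomogenize_surv_X_self K i
      rwa [hui, one_mul] at h0
    · intro j _ hji
      rw [hne j hji, mul_zero]
    · intro h
      exact absurd (Finset.mem_univ i) h
  have hane : a + 1 ≠ a := by fin_cases a <;> decide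
  have hall : ∀ j, A j = 0 := by
    intro j
    have hj : aeval g' (A j) = 0 := by
      by_cases hji : j = i
      · rw [hji]; exact hi
      · exact hne j hji
    refine eq_zero_of_aeval_eq_zeroN K (A j) (hA j) a (a + 1) hane.symm ⟨r + ((a + 1 : Fin 2) : ℕ), by omega⟩ g' ?_ ?_ hj
    · simp only [hg', if_true]
    · simp only [hg', if_neg hane]
  obtain ⟨j, hj⟩ := hAne
  exact hj (hall j)

/-- ★ **The strict-transform equation is regular**: `K[y]/(Σ_j u_j·A_j(g′) + y_{r+a}·C(g′))` is a regular ring as soon as `(A_j)_j, C` have no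
common zero on `ℙ¹` (`K = K̄`) — the engine `isRegularRing_quotient_linN` with the variables `y_{l_j}` (`j ≠ i`), `y_{r+a}` and the constant slot
`A_i(g′)`. [cite: StacksProject, Tag 07PF] -/
theorem isRegularRing_quotient_strict [IsAlgClosed K]
    (hnc : ∀ v : Fin 2 → K, v ≠ 0 → ¬ ((∀ j, MvPolynomial.eval v (A j) = 0) ∧ MvPolynomial.eval v C = 0)) :
    IsRegularRing (MvPolynomial (Fin (r + 1 + 1)) K ⧸ Ideal.span
      {∑ j : Fin (r + 1), ProjectiveSpace.dehomogenize K (i.castSucc.castSucc : Fin (r + 1 + 1 + 1))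
            (X (j.castSucc.castSucc) : MvPolynomial (Fin (r + 1 + 1 + 1)) K) *
          aeval (fun b : Fin 2 => if b = a then (1 : MvPolynomial (Fin (r + 1 + 1)) K) else X ⟨r + b, by omega⟩) (A j) +
        X ⟨r + a, by omega⟩ *
          aeval (fun b : Fin 2 => if b = a then (1 : MvPolynomial (Fin (r + 1 + 1)) K) else X ⟨r + b, by omega⟩) C}) := by
  classical
  set g' : Fin 2 → MvPolynomial (Fin (r + 1 + 1)) K :=
    fun b : Fin 2 => if b = a then (1 : MvPolynomial (Fin (r + 1 + 1)) K) else X ⟨r + b, by omega⟩ with hg'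
  set u : Fin (r + 1) → MvPolynomial (Fin (r + 1 + 1)) K := fun j => ProjectiveSpace.dehomogenize K
    (i.castSucc.castSucc : Fin (r + 1 + 1 + 1)) (X (j.castSucc.castSucc) : MvPolynomial (Fin (r + 1 + 1 + 1)) K) with hu
  -- the variable attached to each slot
  let l' : Fin (r + 1) → Fin (r + 1 + 1) := fun t =>
    if h : t = i then ⟨r + a, by omega⟩ else Classical.choose (dehomogenize_surv_X_surv_of_ne K i t h)
  have hl'i : l' i = ⟨r + a, by omega⟩ := by simp [l']
  have hl'ne : ∀ t (h : t ≠ i), ((l' t : ℕ) < r) ∧ (i.castSucc.castSucc : Fin (r + 1 + 1 + 1)).succAbove (l' t) = t.castSucc.castSucc ∧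
      u t = X (l' t) := by
    intro t h
    have hs := Classical.choose_spec (dehomogenize_surv_X_surv_of_ne K i t h)
    simp only [l', dif_neg h]
    exact ⟨hs.1, hs.2.1, hs.2.2⟩
  let q : Fin (r + 1) → MvPolynomial (Fin (r + 1 + 1)) K := fun t => if t = i then aeval g' C else aeval g' (A t)
  -- rewrite the equation in the engine's shape
  have hshape : ∑ j, u j * aeval g' (A j) + X ⟨r + a, by omega⟩ * aeval g' C = ∑ t, X (l' t) * q t + aeval g' (A i) := by
    rw [← Finset.add_sum_erase _ _ (Finset.mem_univ i), ← Finset.add_sum_erase _ (fun t => X (l' t) * q t) (Finset.mem_univ i)]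
    have hui : u i = 1 := dehomogenize_surv_X_self K i
    have hqi : q i = aeval g' C := by simp [q]
    rw [hui, one_mul, hl'i, hqi]
    have hrest : ∑ t ∈ Finset.univ.erase i, u t * aeval g' (A t) = ∑ t ∈ Finset.univ.erase i, X (l' t) * q t := by
      refine Finset.sum_congr rfl fun t ht => ?_
      have hti : t ≠ i := Finset.ne_of_mem_erase ht
      rw [(hl'ne t hti).2.2]
      simp [q, hti]
    rw [hrest]
    ring
  rw [hshape]
  have hl'inj : Function.Injective l' := by
    intro t t' htt'
    by_cases ht : t = i <;> by_cases ht' : t' = i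
    · rw [ht, ht']
    · exfalso
      have h1 := (hl'ne t' ht').1
      rw [← htt', ht, hl'i] at h1
      simp at h1
    · exfalso
      have h1 := (hl'ne t ht).1
      rw [htt', ht', hl'i] at h1
      simp at h1
    · have h1 := (hl'ne t ht).2.1
      have h2 := (hl'ne t' ht').2.1
      rw [htt'] at h1
      exact Fin.castSucc_injective _ (Fin.castSucc_injective _ (h1.symm.trans h2))
  have hDg : ∀ (t : Fin (r + 1)) (G : MvPolynomial (Fin 2) K), pderiv (l' t) (aeval g' G) = 0 := by
    intro t G
    by_cases ht : t = i
    · rw [ht, hl'i]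
      exact pderiv_aeval_g'_self K a G
    · exact pderiv_aeval_g'_of_lt K a (l' t) (hl'ne t ht).1 G
  refine SubmaxLine.isRegularRing_quotient_linN K l' hl'inj q (aeval g' (A i)) (fun t t' => ?_) (fun t => hDg t (A i)) fun x hx => ?_
  · by_cases ht' : t' = i
    · simp only [q, ht', if_true]
      exact hDg t C
    · simp only [q, if_neg ht']
      exact hDg t (A t')
  · have hv : (fun b => aeval x (g' b)) ≠ 0 := by
      intro h0
      have h1 := congrFun h0 a
      simp only [hg', if_true, map_one, Pi.zero_apply] at h1
      exact one_ne_zero h1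
    refine hnc _ hv ⟨fun j => ?_, ?_⟩
    · have h : aeval x (aeval g' (A j)) = 0 := by
        by_cases hji : j = i
        · rw [hji]; exact hx.2
        · have := hx.1 j
          simp only [q, if_neg hji] at this
          exact this
      rw [SubmaxLine.aeval_aeval_point] at h
      rw [← coe_aeval_eq_eval]; exact h
    · have h := hx.1 i
      simp only [q, if_true] at h
      rw [SubmaxLine.aeval_aeval_point] at h
      rw [← coe_aeval_eq_eval]; exact h

end Family

end SubmaxLinN

end Summit.ResolutionOfSingularities.ResolutionOfSingularities.Cruxes.EquisingularLiftNat.Sections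

end
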